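import Mathlib
import Summits.ValiantsHypothesis.ValiantsHypothesis.Theorems.GrenetZeonTwoDimCoefficientsDualUnipotentUnfoldCore

/-!
# Time-UNFOLDING of a block-triangular nilpotent pencil — the index-mass rungs (part 2 of 2)

Part 1 (`…DualUnipotentUnfoldCore`) builds the unfolded pencil on the sigma state space and proves the trace identity
`trace_unfN_pow_mul_unfM`; this file reindexes it to `Fin (∑ u, r (lev u))` preserving strict upper-triangularity and
derives the rungs: `exists_strictUpper_unfolding`, `sq_le_indexMass_of_blockNilpotent`, `cube_le_indexMass_sq_of_blockNilpotent`
(every block form of a trace-of-power representation of `per_n`, `n ≥ 4`, has index mass ≥ n^{3/2}/12), `cube_le_of_strictLevel`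
(strictly graded pencils obey n³ ≤ 144 m²).  Crux `GrenetZeon.TwoDimCoefficients` (stmt-8062) / rung `DualUnipotentThreeHalves` (stmt-24318):
NOT proved here; `VP ≠ VNP` not moved.  Authored by val-idea-9 g0 (planner seat; Theorems landing by turnkey).
-/


set_option linter.dupNamespace false
set_option autoImplicit false

noncomputable section

namespace Summit.ValiantsHypothesis.ValiantsHypothesis.Cruxes.TwoDimCoefficients.DimTwoCases

open MvPolynomial Matrix
open scoped BigOperators
open Literature.Computability.AlgebraicComplexity


open Unfold in
/-- **U1 — time-unfolding.**  A block-upper-triangular affine pencil whose diagonal constituents have nil-indices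
`≤ r l` unfolds into a STRICTLY upper triangular affine pencil of size `Σ_u r (lev u)` with the same `tr(N^d M)`.
[folklore] -/
theorem exists_strictUpper_unfolding {n m : ℕ} (d : ℕ) (N M : AffMat n m) (lev : Fin m → ℕ) (r : ℕ → ℕ)
    (hN : IsAffine N) (hM : IsAffine M) (hup : ∀ i j : Fin m, lev j < lev i → N i j = 0)
    (hnil : ∀ l, (diagBlock N lev l) ^ (r l) = 0) :
    ∃ (N' M' : AffMat n (∑ u : Fin m, r (lev u))), IsAffine N' ∧ IsAffine M' ∧
      (∀ i j, j ≤ i → N' i j = 0) ∧ (N' ^ d * M').trace = (N ^ d * M).trace := by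
  classical
  -- enumerate the states along the key `(lev u, c, u)` (lexicographic), WITHOUT putting an order instance on `St`
  let φ : St lev r → ℕ ×ₗ (ℕ ×ₗ ℕ) := fun s => toLex (lev s.1, toLex ((s.2 : ℕ), (s.1 : ℕ)))
  have hφ : Function.Injective φ := by
    rintro ⟨u, c⟩ ⟨u', c'⟩ h
    simp only [φ, toLex_inj, Prod.mk.injEq] at h
    obtain ⟨-, hc, hu⟩ := h
    have hu' : u = u' := Fin.ext hu
    subst hu'
    have hc' : c = c' := Fin.ext hc
    subst hc'
    rfl
  have hcard : (Finset.univ : Finset (St lev r)).card = ∑ u : Fin m, r (lev u) := by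
    rw [Finset.card_univ]
    simp [St, Fintype.card_sigma]
  let T : Finset (ℕ ×ₗ (ℕ ×ₗ ℕ)) := Finset.univ.image φ
  have hT : T.card = ∑ u : Fin m, r (lev u) := by
    rw [Finset.card_image_of_injective _ hφ, hcard]
  let ω := T.orderEmbOfFin hT
  have hmem : ∀ i : Fin (∑ u : Fin m, r (lev u)), ∃ s : St lev r, φ s = ω i := by
    intro i
    have hi : ω i ∈ T := T.orderEmbOfFin_mem hT i
    obtain ⟨s, -, hs⟩ := Finset.mem_image.mp hi
    exact ⟨s, hs⟩
  choose g hg using hmem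
  have hginj : Function.Injective g := by
    intro i j h
    apply ω.injective
    rw [← hg, ← hg, h]
  have hbij : Function.Bijective g := by
    rw [Fintype.bijective_iff_injective_and_card]
    refine ⟨hginj, ?_⟩
    rw [Fintype.card_fin, ← Finset.card_univ, hcard]
  let e : Fin (∑ u : Fin m, r (lev u)) ≃ St lev r := Equiv.ofBijective g hbij
  have he : ∀ i, e i = g i := fun i => rfl
  refine ⟨(unfN lev r N).submatrix e e, (unfM lev r M).submatrix e e, ?_, ?_, ?_, ?_⟩
  · intro i j
    simp only [Matrix.submatrix_apply, unfN]
    split_ifs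
    · exact hN _ _
    · rw [totalDegree_zero]; exact Nat.zero_le _
  · intro i j
    simp only [Matrix.submatrix_apply, unfM]
    split_ifs
    · exact hM _ _
    · rw [totalDegree_zero]; exact Nat.zero_le _
  · intro i j hji
    simp only [Matrix.submatrix_apply, unfN]
    rw [if_neg]
    intro hcond
    have hlt : φ (e i) < φ (e j) := by
      rcases hcond with ⟨h1, h2⟩ | ⟨h1, h2⟩
      · simp only [φ, Prod.Lex.toLex_lt_toLex, h1, lt_self_iff_false, true_and, false_or]
        left; omega
      · simp only [φ, Prod.Lex.toLex_lt_toLex]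
        left; exact h1
    rw [he, he, hg, hg, ω.lt_iff_lt] at hlt
    exact absurd hlt (not_lt.mpr hji)
  · have htr : ∀ (A : Matrix (St lev r) (St lev r) (MvPolynomial (Fin n × Fin n) ℂ)),
        (A.submatrix e e).trace = A.trace := by
      intro A
      simp only [Matrix.trace, Matrix.diag_apply, Matrix.submatrix_apply]
      exact e.sum_comp (fun s => A s s)
    have hre : ((unfN lev r N).submatrix e e) ^ d * (unfM lev r M).submatrix e e =
        (unfN lev r N ^ d * unfM lev r M).submatrix e e := by
      have h1 : ((unfN lev r N).submatrix e e) ^ d = (unfN lev r N ^ d).submatrix e e := by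
        induction d with
        | zero => rw [pow_zero, pow_zero, Matrix.submatrix_one_equiv]
        | succ d ih => rw [pow_succ, pow_succ, ih, Matrix.submatrix_mul_equiv]
      rw [h1, Matrix.submatrix_mul_equiv]
    rw [hre, htr, trace_unfN_pow_mul_unfM N M hup hnil d]

/-- **Portrait inequality (general `q`).**  If `per_n = tr(N^d M)` for a block-upper affine pencil whose diagonal
constituents have nil-indices `≤ r l`, then `q·n² ≤ 2n(I + q) + I·q²` for every `q ≥ 1`, `I = Σ_u r (lev u)` the index
mass — the triangularisable rung `sq_le_of_trace_pow_mul_strictUpper'` transported through the unfolding. -/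
theorem sq_le_indexMass_of_blockNilpotent {n m d q : ℕ} (N M : AffMat n m) (lev : Fin m → ℕ) (r : ℕ → ℕ)
    (hN : IsAffine N) (hM : IsAffine M) (hup : ∀ i j : Fin m, lev j < lev i → N i j = 0)
    (hnil : ∀ l, (diagBlock N lev l) ^ (r l) = 0)
    (hper : perPoly (Fin n) ℂ = (N ^ d * M).trace) (hq : 1 ≤ q) :
    q * n ^ 2 ≤ 2 * n * ((∑ u : Fin m, r (lev u)) + q) + (∑ u : Fin m, r (lev u)) * q ^ 2 := by
  obtain ⟨N', M', hN', hM', htri, htr⟩ := exists_strictUpper_unfolding d N M lev r hN hM hup hnil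
  exact sq_le_of_trace_pow_mul_strictUpper' N' M' hN' hM' htri (hper.trans htr.symm) hq

/-- **Portrait inequality (`n ≥ 4`): index mass `≥ n^{3/2}/12`.**  `n³ ≤ 144·(Σ_u r (lev u))²` for every block form
of every trace-of-power representation `per_n = tr(N^d M)` with diagonal nil-indices `≤ r l`. -/
theorem cube_le_indexMass_sq_of_blockNilpotent {n m d : ℕ} (hn : 4 ≤ n) (N M : AffMat n m) (lev : Fin m → ℕ)
    (r : ℕ → ℕ) (hN : IsAffine N) (hM : IsAffine M) (hup : ∀ i j : Fin m, lev j < lev i → N i j = 0)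
    (hnil : ∀ l, (diagBlock N lev l) ^ (r l) = 0) (hper : perPoly (Fin n) ℂ = (N ^ d * M).trace) :
    n ^ 3 ≤ 144 * (∑ u : Fin m, r (lev u)) ^ 2 := by
  set m' := ∑ u : Fin m, r (lev u) with hm'
  set s := Nat.sqrt n with hs
  have hs1 : s ^ 2 ≤ n := Nat.sqrt_le' n
  have hs2 : n < (s + 1) ^ 2 := Nat.lt_succ_sqrt' n
  have hs0 : 1 ≤ s := Nat.succ_le_of_lt (Nat.sqrt_pos.2 (by omega))
  have hrung := sq_le_indexMass_of_blockNilpotent N M lev r hN hM hup hnil hper hs0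
  rw [← hm'] at hrung
  have h1 : s * n ^ 2 ≤ n * (3 * m' + 2 * s) := by nlinarith [hrung, hs1]
  have hn0 : 0 < n := by omega
  have h2 : s * n ≤ 3 * m' + 2 * s := by
    have h1' : n * (s * n) ≤ n * (3 * m' + 2 * s) := by nlinarith [h1]
    exact Nat.le_of_mul_le_mul_left h1' hn0
  have h3 : s * n ≤ 6 * m' := by nlinarith [h2, hn, Nat.mul_le_mul_left s hn]
  have h4 : (s * n) * (s * n) ≤ (6 * m') * (6 * m') := Nat.mul_le_mul h3 h3
  have hs3 : n ≤ 4 * s ^ 2 := by nlinarith [hs2, hs0]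
  have h5 : n * n ^ 2 ≤ (4 * s ^ 2) * n ^ 2 := Nat.mul_le_mul_right (n ^ 2) hs3
  nlinarith [h4, h5]

/-- **Strictly graded pencils (every DAG / layered / torus-equivariant construction): the rung at index mass `m`.**
If `N u v ≠ 0 ⇒ ℓ u < ℓ v` for SOME level function `ℓ` (no order on `Fin m` assumed), the block form `lev = ℓ` has zero
diagonal constituents (`r ≡ 1`), so `n³ ≤ 144·m²` for `n ≥ 4`.  This is the triangularisable rung freed from the given
order of `Fin m` — the class on which the line's crux `CheapIndexMass` holds with `C = 1`. -/
theorem cube_le_of_strictLevel {n m d : ℕ} (hn : 4 ≤ n) (N M : AffMat n m) (ℓ : Fin m → ℕ)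
    (hN : IsAffine N) (hM : IsAffine M) (hstrict : ∀ u v : Fin m, N u v ≠ 0 → ℓ u < ℓ v)
    (hper : perPoly (Fin n) ℂ = (N ^ d * M).trace) : n ^ 3 ≤ 144 * m ^ 2 := by
  have hup : ∀ i j : Fin m, ℓ j < ℓ i → N i j = 0 := by
    intro i j hij
    by_contra h
    exact absurd (hstrict i j h) (not_lt.mpr hij.le)
  have hnil : ∀ l, (diagBlock N ℓ l) ^ ((fun _ : ℕ => 1) l) = 0 := by
    intro l
    rw [pow_one]
    refine Matrix.ext (fun i j => ?_)
    simp only [diagBlock, Matrix.zero_apply]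
    split_ifs with h
    · by_contra hne
      have := hstrict i j hne
      omega
    · rfl
  have h := cube_le_indexMass_sq_of_blockNilpotent hn N M ℓ (fun _ => 1) hN hM hup hnil hper
  simpa using h

/-- Sanity / calibration: a strictly upper triangular pencil is the block form `lev = id`, `r ≡ 1`, of index mass `m`
(so the corollaries above contain the triangularisable rung). -/
theorem diagBlock_val_pow_one_eq_zero {n m : ℕ} (N : AffMat n m) (htri : ∀ i j : Fin m, j ≤ i → N i j = 0) (l : ℕ) :
    (diagBlock N (fun u : Fin m => (u : ℕ)) l) ^ ((fun _ : ℕ => 1) l) = 0 := by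
  rw [pow_one]
  refine Matrix.ext (fun i j => ?_)
  simp only [diagBlock, Matrix.zero_apply]
  split_ifs with h
  · exact htri i j (le_of_eq (Fin.ext (h.2.trans h.1.symm)))
  · rfl

end Summit.ValiantsHypothesis.ValiantsHypothesis.Cruxes.TwoDimCoefficients.DimTwoCases

end
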